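import Mathlib
import HarnessLib
import Summits.HubbardSuperconductivity.HubbardSuperconductivity.Theorems.KLProgrammeKLRegimeTwoVolumeTowerBaseTransfer

/-!
# Route `KLProgramme` — crux K3, VL child `KLRegimeVolumeLimitV17F2` (stmt-HubbardSuperconductivity-20440), blueprint v5 M5 / W4 base data: THE TWO-VOLUME
# DIFFERENCE OF THE BASE TRANSFER IS THE FRAME DIFFERENCE OF THE SCALE-0 CROSS-GRID OVERLAP (conjuncts 4–5 of the base-transfer bundle `hdataT` of
# `…TowerBase` / `towerDataT_of_partsD`, reduced; seat hubbard-kl-k3c4-p1 g14; `--supports` 20440)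

The base of the nested two-volume induction compares the fine volume's base transfer at ITS OWN frame `K_{bL}` with the one at the COARSE frame `K_L`:
`hdataT` asks for the rows and columns of `klBaseTransfer (bL) M β μ K_{bL} − klBaseTransfer (bL) M β μ K_L` to be `≤ δ_L → 0`.  The base transfer is
`(ε • E(F_0[K])·S_N) ⊕ (klSrcPlainBlock·S_N)` (`…TowerBaseDefs`); the plain source block does not see the frame, so the difference lives on the alive copies
`(0, 0)` and IS the frame difference `ε • (E(F_0[K′]) − E(F_0[K]))·S_N` of the scale-0 cross-grid overlap kernel — the same object as k3c4-p2's transfer frame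
defect (`exists_transfer_frameDefect_rate`, sector-to-sector) on the grid legs:

* `klBaseTransfer_apply_zero_zero / _one_one / _zero_one / _one_zero` — the four copy blocks;
* `klBaseTransfer_sub_apply` — the difference, entrywise;
* **`sum_norm_klBaseTransfer_sub_row_le`**, **`sum_norm_klBaseTransfer_sub_col_le`** — rows / columns of the two-volume difference `≤ δ` from rows / columns
  `≤ δ` of `ε • (E(F_0[K′]) − E(F_0[K]))·S_N` (`0 ≤ δ`).

So conjuncts 4–5 of `hdataT` = ONE named ask to the scale-0 lane: the rows/columns of the frame difference of `ε • E(klAnisoFamily … K klE0 0)·hubbardGridSub`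
at `(K′, K) = (K_{bL}, K_L)`, `→ 0` as `L → ∞`.  Proofs only; no definition. [cite: BenfattoGiulianiMastropietro2006, §2.7 (2.71), §3 (3.3)]
-/

noncomputable section

namespace Summit.HubbardSuperconductivity.HubbardSuperconductivity.Theorems.TwoVolumeSource

set_option linter.dupNamespace false -- summit = problem name (single-conjunct summit), D-0017

open Finset Literature.MathematicalPhysics.QuantumLattice GrassmannAlgebra Literature.Probability.LatticeModels
open Summit.HubbardSuperconductivity.HubbardSuperconductivity.Theorems.KLProgrammeLegKernels
open Summit.HubbardSuperconductivity.HubbardSuperconductivity.Theorems.KLRegimeSplit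
open Summit.HubbardSuperconductivity.HubbardSuperconductivity.Theorems.EngineV8
open Summit.HubbardSuperconductivity.HubbardSuperconductivity.Theorems.TwoVolumeDefect

variable {V M : ℕ} [NeZero V]

/-- Entries of the base transfer between the alive copies `0`: the scaled overlap `ε • E(F_0[K])·S_N`. [folklore] -/
theorem klBaseTransfer_apply_zero_zero (β μ : ℝ) (K : TrigPolyC4v) (Y : SpaceTimeIdx V M × SectorLeg (sectorCount 0))
    (y : GridLeg (GridPoint V (klGridN M))) :
    klBaseTransfer V M β μ K (Y, 0) (y, 0) =
      ((((imagTimeWeight β M : ℝ) : ℂ) • sectorAnalysisMatrix V M β (klAnisoFamily V M β μ K klE0 0)) * hubbardGridSub V M β (klGridN M)) Y y := by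
  rw [klBaseTransfer_apply, if_pos ⟨rfl, rfl⟩]

/-- Entries between the source copies `1`: the plain source block (frame-free). [folklore] -/
theorem klBaseTransfer_apply_one_one (β μ : ℝ) (K : TrigPolyC4v) (Y : SpaceTimeIdx V M × SectorLeg (sectorCount 0))
    (y : GridLeg (GridPoint V (klGridN M))) :
    klBaseTransfer V M β μ K (Y, 1) (y, 1) = (klSrcPlainBlock V M β * hubbardGridSub V M β (klGridN M)) Y y := by
  rw [klBaseTransfer_apply]; dsimp only; rw [if_neg (by decide), if_pos ⟨rfl, rfl⟩]

/-- Entries from copy `0` to copy `1` vanish. [folklore] -/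
theorem klBaseTransfer_apply_zero_one (β μ : ℝ) (K : TrigPolyC4v) (Y : SpaceTimeIdx V M × SectorLeg (sectorCount 0))
    (y : GridLeg (GridPoint V (klGridN M))) : klBaseTransfer V M β μ K (Y, 0) (y, 1) = 0 := by
  rw [klBaseTransfer_apply]; dsimp only; rw [if_neg (by decide), if_neg (by decide)]

/-- Entries from copy `1` to copy `0` vanish. [folklore] -/
theorem klBaseTransfer_apply_one_zero (β μ : ℝ) (K : TrigPolyC4v) (Y : SpaceTimeIdx V M × SectorLeg (sectorCount 0))
    (y : GridLeg (GridPoint V (klGridN M))) : klBaseTransfer V M β μ K (Y, 1) (y, 0) = 0 := by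
  rw [klBaseTransfer_apply]; dsimp only; rw [if_neg (by decide), if_neg (by decide)]

/-- **The frame difference of the base transfer, entrywise**: on the alive copies it is the frame difference of the scaled cross-grid overlap, elsewhere `0`.
[cite: BenfattoGiulianiMastropietro2006, §2.7 (2.71)] -/
theorem klBaseTransfer_sub_apply (β μ : ℝ) (K' K : TrigPolyC4v) (p' : SrcLabel V M 0) (p : GridLeg (GridPoint V (klGridN M)) × Fin 2) :
    klBaseTransfer V M β μ K' p' p - klBaseTransfer V M β μ K p' p =
      if p'.2 = 0 ∧ p.2 = 0 then
        ((((imagTimeWeight β M : ℝ) : ℂ) • (sectorAnalysisMatrix V M β (klAnisoFamily V M β μ K' klE0 0) -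
            sectorAnalysisMatrix V M β (klAnisoFamily V M β μ K klE0 0))) * hubbardGridSub V M β (klGridN M)) p'.1 p.1
      else 0 := by
  rw [klBaseTransfer_apply, klBaseTransfer_apply]
  split_ifs with h00 h11
  · rw [smul_sub, Matrix.sub_mul, Matrix.sub_apply]
  · exact sub_self _
  · exact sub_self _

/-- **Rows of the two-volume difference of the base transfer from rows of the overlap's frame difference.** [cite: BenfattoGiulianiMastropietro2006, §2.7 (2.71), §3 (3.3)] -/
theorem sum_norm_klBaseTransfer_sub_row_le (β μ : ℝ) (K' K : TrigPolyC4v) {δ : ℝ} (hδ : 0 ≤ δ)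
    (hrow : ∀ Y : SpaceTimeIdx V M × SectorLeg (sectorCount 0), ∑ y : GridLeg (GridPoint V (klGridN M)),
      ‖((((imagTimeWeight β M : ℝ) : ℂ) • (sectorAnalysisMatrix V M β (klAnisoFamily V M β μ K' klE0 0) -
          sectorAnalysisMatrix V M β (klAnisoFamily V M β μ K klE0 0))) * hubbardGridSub V M β (klGridN M)) Y y‖ ≤ δ)
    (x : SrcLabel V M 0) :
    ∑ y : GridLeg (GridPoint V (klGridN M)) × Fin 2, ‖klBaseTransfer V M β μ K' x y - klBaseTransfer V M β μ K x y‖ ≤ δ := by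
  obtain ⟨Y, c⟩ := x
  simp_rw [klBaseTransfer_sub_apply]
  revert c
  rw [Fin.forall_fin_two]
  refine ⟨?_, ?_⟩
  · rw [Fintype.sum_prod_type]
    simp_rw [Fin.sum_univ_two]
    simp only [true_and, if_true, Fin.one_eq_zero_iff, OfNat.ofNat_ne_one, if_false, norm_zero, add_zero]
    exact hrow Y
  · rw [Fintype.sum_prod_type]
    simp only [Fin.one_eq_zero_iff, OfNat.ofNat_ne_one, false_and, if_false, norm_zero, Finset.sum_const_zero]
    exact hδ

/-- **Columns of the two-volume difference of the base transfer from columns of the overlap's frame difference.** [cite: BenfattoGiulianiMastropietro2006, §2.7 (2.71), §3 (3.3)] -/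
theorem sum_norm_klBaseTransfer_sub_col_le (β μ : ℝ) (K' K : TrigPolyC4v) {δ : ℝ} (hδ : 0 ≤ δ)
    (hcol : ∀ y : GridLeg (GridPoint V (klGridN M)), ∑ Y : SpaceTimeIdx V M × SectorLeg (sectorCount 0),
      ‖((((imagTimeWeight β M : ℝ) : ℂ) • (sectorAnalysisMatrix V M β (klAnisoFamily V M β μ K' klE0 0) -
          sectorAnalysisMatrix V M β (klAnisoFamily V M β μ K klE0 0))) * hubbardGridSub V M β (klGridN M)) Y y‖ ≤ δ)
    (y : GridLeg (GridPoint V (klGridN M)) × Fin 2) :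
    ∑ x : SrcLabel V M 0, ‖klBaseTransfer V M β μ K' x y - klBaseTransfer V M β μ K x y‖ ≤ δ := by
  obtain ⟨yg, c⟩ := y
  simp_rw [klBaseTransfer_sub_apply]
  revert c
  rw [Fin.forall_fin_two]
  refine ⟨?_, ?_⟩
  · rw [Fintype.sum_prod_type]
    simp_rw [Fin.sum_univ_two]
    simp only [and_true, if_true, Fin.one_eq_zero_iff, OfNat.ofNat_ne_one, if_false, norm_zero, add_zero]
    exact hcol yg
  · rw [Fintype.sum_prod_type]
    simp only [Fin.one_eq_zero_iff, OfNat.ofNat_ne_one, and_false, if_false, norm_zero, Finset.sum_const_zero]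
    exact hδ

end Summit.HubbardSuperconductivity.HubbardSuperconductivity.Theorems.TwoVolumeSource

end
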